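/- Copyright: the b2b-balaban cell (near-miss cell 7), T⁴-continuum fan-out, row NE7b owner lineage
`b2b-balaban-t4-ne7b-p1` (gen 23), node U5c COUNT member.  Released under the licence of the surrounding project. -/
import Summits.QuantumFields.BalabanUV.T4Continuum.Support.HistoryRealiseCellsRunEnd

/-!
# Realised histories: THE END OF RECORD UNDER THE TWO PINS `(B)` AND `BetaPertHyp`, IN THE APEX QUANTIFIER ORDER

Summits-side support leaf of the T⁴-continuum cell (rung (B)+1 on a FINITE torus only; NOT infinite volume, NOT the
mass gap, NOT the Clay statement; NOT a proof of the spine estimate NE7b).  Row S12 ∕ node A12-I of the swarm claim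
table `t4/b2b-balaban-t4-ne7b-p1/LEAVES-NE7b.md` (owner sub-row S12f «PINNED END», v3.14).

WHAT.  The END OF RECORD v2 of the COUNT road, `HistoryRealiseCellsRunEnd.hybridNE7_of_realisedDomainsRun_printed`
(p216885), displays its FLOW side as six box-bound ∕ smallness binders `hb hlo hhi hγ hγβ S` (+ `hp₀ hrr hβ`), its
infrared smallness as `hir : irThresholdTLE C F.L rr β₀ ≤ log (g²)⁻¹` at a free renormalised coupling `g`, and its (B)
side as a `Cor3With` witness `hcor` at a free `γB`.  Here the same END is stated UNDER THE TWO TREE PINS BY NAME —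
`(hB : B16.EndStatementBPrinted D.C)` (Bałaban's UV stability in its printed conditional form) and
`(hβ : BetaPertHyp D.βfun)` (the cell's β-hypothesis) — and IN THE QUANTIFIER ORDER OF THE HEADLINE PREFIX
`T4ContinuumYM4Torus.ForSmallCouplings`:
    `∃ γ₁ > 0, ∀ γ ∈ ]0, γ₁], ∃ g₁ > 0, ∀ g ∈ ]0, g₁], ∃ Em ≥ 0, ∀ g₀, D.Tuned γ g g₀ → (∀ term data + H3 + seam ⇒ HybridNE7)`:
**`hybridNE7_of_realisedDomainsRun_pinned`**.  The thresholds are EXPLICIT in the proof: `γ₁ := min γ₁ᶠ γB` with `γ₁ᶠ`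
the smallness threshold of `HistoryFlow.flowSide_of_betaPertHyp` (⇐ `BetaPertHyp`, at the exponent `max C.p₀ rr`) and
`γB` the `Cor3_250` threshold of the pin (B); `g₁ := min 1 (exp (−irThresholdTLE C F.L rr β₀ ∕ 2))` (so that
`irThresholdTLE … ≤ log (g²)⁻¹` on `]0, g₁]` — the threshold is a function of the constants only, leaf-02's
`HistoryExitLE.irThresholdTLE`, R-OWNER-22-11); `Em := max (em g) 0`.  They are fixed BEFORE the term index type, the
payload types and every piece of term data are introduced (all of which are bound INSIDE the prefix), so no threshold can
depend on them.  Discharged on the way, by name: `4 ≤ F.L` (`T4Family.hL11`), `β₀ ≤ ½` (from the displayed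
`F.L·β₀ ≤ 1`).  [folklore] composition by name; no `def`, no `[cite:]` tag, nothing printed asserted.

DISPLAYED (unchanged from the END of record, now per tuned run inside the prefix): the constants' side conditions (B1:
`Dominates C O`, `ThresholdOK`, `0 < C.μ`, `κ₁`∕`E₀` largeness, `0 < β₀`, `F.L·β₀ ≤ 1`, `13 ≤ C.n₁`), the sign
conventions `B16.SignConventions D.C` of the datum, the (2.5) side condition `hR` on the size function `R` with `1 ≤ R`,
the two runs' term families with their (α) integral bounds, mass floors, site budgets and envelopes (B3), H3 — the terms
read as pedigrees realised by the run's own profile with their domains (`RealisedDomainsR …`), the realised per-step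
costs below `costT`, the per-term price sentence over `pshapeTH` in print's currency, the `Regeneration` numerator
readings `up ∕ dead_nonneg ∕ resum ∕ F_nonneg` (both runs) — and the seam inputs `ShellWeightBound` (NE7c),
`ReindexedBudget` (NE7 core), four summable rates.

HONEST.  This is the END of record re-quantified, not a new estimate: the conclusion `HybridNE7 …` and every H3 ∕ (B)-side ∕
seam binder are token-identical to p216885's; what changed is only that the flow facts now follow from `BetaPertHyp` BY
NAME and the `Cor3With` witness from the pin `B16.EndStatementBPrinted` BY NAME (its `Thm1Printed` conjunct is not used).
NE7b NOT proved; spine 0∕9.  HONEST DEPENDENCY (cell): continuum YM on T⁴ ⇐ BetaPertH ∧ nine spine estimates (0/9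
proved); BetaPertH ⇐ (D1) ∧ (D4) ∧ CAP+tail; G-an2-4 gates asym, D1 and NE2/3/4.  This file changes none of it. -/

open Finset MeasureTheory
open Literature.MathematicalPhysics.QuantumFieldTheory.Balaban1983to89
open Literature.MathematicalPhysics.QuantumFieldTheory.Balaban1983to89.B13ScaleTransfer
open T4PersistenceDictionary T4PersistentHistoryCount T4BankedInduction T4PrintedShapeBanking
open T4WeightBudget T4GlobalDenominator T4LiveClassFibration T4LiveStructureGas T4LiveGasToTerms T4RecordPriceSeam
open T4PartnerMultiplicity T4IndicatorShell T4MatchingAssembly T4MatchingClosure T4MatchingClosureSocket T4Continuum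
open T4StabilitySocket T4BranchingRecordsGas T4TaggedShapeBanking T4CanonicalMenus T4RenewalChains
open Summit.QuantumFields.BalabanUV.T4Continuum.PlacementBatch
open Summit.QuantumFields.BalabanUV.T4Continuum.PlacementSkeleton
open Summit.QuantumFields.BalabanUV.T4Continuum.CountThresholdUniform
open Summit.QuantumFields.BalabanUV.T4Continuum.CountThresholdExit
open Summit.QuantumFields.BalabanUV.T4Continuum.CountSeamJunction
open Summit.QuantumFields.BalabanUV.T4Continuum.LateMergers
open Summit.QuantumFields.BalabanUV.T4Continuum.HistoryFlow
open Summit.QuantumFields.BalabanUV.T4Continuum.HistoryRegeneration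
open Summit.QuantumFields.BalabanUV.T4Continuum.HistoryTables
open Summit.QuantumFields.BalabanUV.T4Continuum.HistoryAssemblyTrees
open Summit.QuantumFields.BalabanUV.T4Continuum.HistoryAssemblyTerms
open Summit.QuantumFields.BalabanUV.T4Continuum.HistoryAssemblyPedigree
open Summit.QuantumFields.BalabanUV.T4Continuum.HistoryConstants
open Summit.QuantumFields.BalabanUV.T4Continuum.HistoryGen
open Summit.QuantumFields.BalabanUV.T4Continuum.ZoneSkeleton
open Summit.QuantumFields.BalabanUV.T4Continuum.HistorySocketTH
open Summit.QuantumFields.BalabanUV.T4Continuum.HistoryCaps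
open Summit.QuantumFields.BalabanUV.T4Continuum.HistoryAssemblyPrice
open Summit.QuantumFields.BalabanUV.T4Continuum.HistoryBankingLE
open Summit.QuantumFields.BalabanUV.T4Continuum.HistoryTreeShapeLE
open Summit.QuantumFields.BalabanUV.T4Continuum.HistoryExitLE
open Summit.QuantumFields.BalabanUV.T4Continuum.HistoryAssemblyTermsLE
open Summit.QuantumFields.BalabanUV.T4Continuum.HistoryRealise
open Summit.QuantumFields.BalabanUV.T4Continuum.HistoryAssemblyRealiseLE
open Summit.QuantumFields.BalabanUV.T4Continuum.HistoryAssemblyRealisePrice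
open Summit.QuantumFields.BalabanUV.T4Continuum.HistoryZones
open Summit.QuantumFields.BalabanUV.T4Continuum.HistoryAssemblyRealiseRun
open Summit.QuantumFields.BalabanUV.T4Continuum.HistoryAssemblyRealiseRunEnd
open Summit.QuantumFields.BalabanUV.T4Continuum.HistoryRealiseCells
open Summit.QuantumFields.BalabanUV.T4Continuum.HistoryRealiseCellsRun
open Summit.QuantumFields.BalabanUV.T4Continuum.HistoryRealiseCellsRunEnd

namespace Summit.QuantumFields.BalabanUV.T4Continuum.HistoryRealiseCellsRunPinned

noncomputable section

universe u v w

section Pinned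

variable {F : T4Family} {G : Type*} [GaugeGroup G] [MeasurableSpace G] [HaarData G] [RegularGaugeGroup G]

/-- The infrared clause from the explicit coupling threshold: for `0 < g ≤ exp (−θ∕2)` one has `θ ≤ log (g²)⁻¹`.
[folklore] -/
theorem le_log_inv_sq_of_le_exp {θ g : ℝ} (hg : 0 < g) (hgle : g ≤ Real.exp (-θ / 2)) :
    θ ≤ Real.log (g ^ 2)⁻¹ := by
  have h2 : Real.log g ≤ -θ / 2 := by
    rw [← Real.log_exp (-θ / 2)]
    exact Real.log_le_log hg hgle
  rw [Real.log_inv, Real.log_pow]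
  push_cast
  linarith

/-- The printed range `11 < L` of the family gives the torus-side constant `4 ≤ L` of the geometric lemmas (row S1b).
[folklore] -/
theorem four_le_L (F : T4Family) : 4 ≤ F.L := by
  have := F.hL11
  omega

/-- From the displayed `F.L · β₀ ≤ 1` (and `11 < L`): `β₀ ≤ 1` and `β₀ ≤ ½`. [folklore] -/
theorem beta0_le_of_L_mul_le {F : T4Family} {β₀ : ℝ} (hLβ : (F.L : ℝ) * β₀ ≤ 1) :
    β₀ ≤ 1 ∧ β₀ ≤ 1 / 2 := by
  have hL : (11 : ℝ) < F.L := by exact_mod_cast F.hL11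
  constructor <;> nlinarith

/-- **NE7b's COUNT EXIT — THE END OF RECORD v2 UNDER THE PINS `(B)` AND `BetaPertHyp`, IN THE APEX QUANTIFIER ORDER.**
`HistoryRealiseCellsRunEnd.hybridNE7_of_realisedDomainsRun_printed` (p216885) with: the six flow binders
`hb hlo hhi hγ hγβ S` (+ `hp₀ hrr hβ`) DISCHARGED from `hβ : BetaPertHyp D.βfun` by `HistoryFlow.flowSide_of_betaPertHyp`
at the exponent `max C.p₀ rr`; the (B)-side witness `hcor : B16.Cor3With D.C γB em ep` + `γ ≤ γB` DISCHARGED from the pin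
`hB : B16.EndStatementBPrinted D.C` (its `Cor3_250` conjunct); the infrared clause `hir` DISCHARGED on `]0, g₁]`,
`g₁ := min 1 (exp (−irThresholdTLE C F.L rr β₀ ∕ 2))`; `4 ≤ F.L` and `β₀ ≤ ½` from `T4Family.hL11` and `F.L·β₀ ≤ 1`.
Quantifier order = `T4ContinuumYM4Torus.ForSmallCouplings` (with the (B)-constant `Em` after `g`, as in
`HistoryRegeneration.regeneration_of_endStatementBPrinted`): the thresholds are fixed before the term index type `ι`, the
payload types `α π` and all term data, which are bound inside.  Everything after `D.Tuned γ g g₀ →` is the END of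
record's binder list verbatim (constants moved to the front), and the conclusion is its conclusion with
`max (em g) 0 ↦ Em`.  DISPLAYED: constants' side conditions, `B16.SignConventions D.C`, the (2.5) side condition on `R`,
the two runs' (α) bounds ∕ floors ∕ sites ∕ envelopes, H3 (realised reading with domains, realised costs, printed price
sentence, numerator readings), NE7c's `ShellWeightBound`, NE7's `ReindexedBudget`, four summable rates.  NE7b NOT proved.
[folklore] -/
theorem hybridNE7_of_realisedDomainsRun_pinned (D : FiniteEpsData F G)
    -- the two pins, BY NAME, and the sign conventions of the datum
    (hB : B16.EndStatementBPrinted D.C) (hβ : BetaPertHyp D.βfun) (hsign : B16.SignConventions D.C)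
    -- the constants (symbolic) and their side conditions
    {C : T4PrintedShapeBanking.Consts} {O : PrintedO1s} (hD : Dominates C O)
    {rr : ℕ} {β₀ : ℝ} (h : ThresholdOK C F.L rr β₀) (hμ : 0 < C.μ) (d n : ℕ)
    (hκ₁ : (d : ℝ) * Real.log F.L + 2 * Real.log 2 ≤ C.κ₁) (hE₀ : Real.log (2 + birthMass C) ≤ C.E₀)
    (hβ₀ : 0 < β₀) (hLβ : (F.L : ℝ) * β₀ ≤ 1) (hn₁ : 13 ≤ C.n₁) (hn : 0 < n) :
    ∃ γ₁ : ℝ, 0 < γ₁ ∧ ∀ γ : ℝ, 0 < γ → γ ≤ γ₁ → ∃ g₁ : ℝ, 0 < g₁ ∧ ∀ g : ℝ, 0 < g → g ≤ g₁ →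
      ∃ Em : ℝ, 0 ≤ Em ∧ ∀ g₀ : ℕ → ℝ, D.Tuned γ g g₀ →
      ∀ {ι : Type u} [DecidableEq ι] {α : Type v} {π : Type w} [DecidableEq α] [DecidableEq π]
        (l₀ vol : ℝ) (K₀ : ℕ) (T : ℕ → Finset ι) (A A' shA shB dead dead' : ℕ → ℝ → ι → ℝ)
        (nup mup : ℕ → ℝ → ℝ) (Nup : ℝ) (Cc Rr CcRec RrRec : ℕ → ℝ → ι → ℝ) (ν u s₂ q₀ r s Wsh : ℕ → ℝ)
        -- the observable and the two runs' (α) integral bounds, floors, site budgets, envelopes ((B) side, displayed)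
        (obs : (K : ℕ) → GaugeField (F.P K) 0 G → ℝ) (B : ℝ),
        (∀ K, Measurable (obs K)) → (∀ K U, |obs K U| ≤ B) →
        (∀ K t, |t| ≤ l₀ → K₀ ≤ K →
          ∫ U, Real.exp (t * obs K U) * D.dens K (g₀ K) 0 U ∂fieldMeasure (F.P K) 0 G ≤ ∑ τ ∈ T K, A K t τ) →
        (∀ K t, |t| ≤ l₀ → K₀ ≤ K →
          ∫ U, Real.exp (t * obs (K + 1) U) * D.dens (K + 1) (g₀ (K + 1)) 0 U ∂fieldMeasure (F.P (K + 1)) 0 G ≤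
            ∑ τ ∈ T K, A' K t τ) →
      ∀ (c₀ n₁ : ℝ), 0 < c₀ → (∀ K, K₀ ≤ K → c₀ ≤ smallFieldMass D K (g₀ K)) →
        (∀ K, K₀ ≤ K → c₀ ≤ smallFieldMass D (K + 1) (g₀ (K + 1))) →
        (∀ K, K₀ ≤ K → ((D.C ⟨K, F.m, g₀ K⟩).numSites K : ℝ) ≤ n₁) →
        (∀ K, K₀ ≤ K → ((D.C ⟨K + 1, F.m, g₀ (K + 1)⟩).numSites (K + 1) : ℝ) ≤ n₁) →
        0 ≤ Nup → (∀ K t, |t| ≤ l₀ → K₀ ≤ K → 0 ≤ nup K t ∧ nup K t ≤ Nup) →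
        (∀ K t, |t| ≤ l₀ → K₀ ≤ K → 0 ≤ mup K t ∧ mup K t ≤ Nup) →
      -- the (2.5) side condition on the size function
      ∀ (R : ℕ → ℕ → ℕ), (∀ K s, s ≤ K → B14.IsRj F.L rr ((D.C ⟨K, F.m, g₀ K⟩).flow.g s) (R K s)) →
        (∀ K, K₀ ≤ K → ∀ t, 1 ≤ R K t) →
      -- H3: the terms read as pedigrees REALISED BY THE RUN'S OWN PROFILE with their DOMAINS
      ∀ (ped : ℕ → ι → Pedigree α π) (cellP : ℕ → ι → π → Pt d × Finset (Pt d)) (liveC : ℕ → ι → Finset α)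
        (Zd : ℕ → ι → α → Finset (Pt d)),
        RealisedDomainsR F.L (runProfile F.L R) n K₀ R T ped cellP liveC Zd →
      -- H3: realised per-step costs of the live members, read below the model's booked cost
      ∀ (κ κ' : ℕ → (Fin d → ℕ) × Gen (Lab α π) → Gen (Lab α π) → ℕ → ℝ),
        (∀ K, K₀ ≤ K → ∀ τ ∈ badTerms (memOf ped liveC (cellOfR n F.L (runProfile F.L R) ped cellP)) jhalf T K,
          ∀ q ∈ memOf ped liveC (cellOfR n F.L (runProfile F.L R) ped cellP) K τ,
          ∀ m ∈ life (padW (dictWT Prod.fst (R K) C.n₁) 0) q.2, κ K q q.2 m ≤ costT Prod.fst C K (R K) q.2 m) →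
        (∀ K, K₀ ≤ K → ∀ τ ∈ badTerms (memOf ped liveC (cellOfR n F.L (runProfile F.L R) ped cellP)) jhalf T K,
          ∀ q ∈ memOf ped liveC (cellOfR n F.L (runProfile F.L R) ped cellP) K τ,
          ∀ m ∈ life (padW (dictWT Prod.fst (R K) C.n₁) 0) q.2, κ' K q q.2 m ≤ costT Prod.fst C K (R K) q.2 m) →
      -- H3: the per-term price sentence in PRINT's currency, both runs
      ∀ (Fc Rf Fc' Rf' : ℕ → Finset (BSlot (Fin d → ℕ) PEv) → ℝ),
        (∀ K t, |t| ≤ l₀ → K₀ ≤ K →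
          ∀ τ ∈ badTerms (memOf ped liveC (cellOfR n F.L (runProfile F.L R) ped cellP)) jhalf T K,
          Fc K (bstrOf Prod.fst (memOf ped liveC (cellOfR n F.L (runProfile F.L R) ped cellP)) K τ) *
              Rf K (bstrOf Prod.fst (memOf ped liveC (cellOfR n F.L (runProfile F.L R) ped cellP)) K τ) ≤
            ∏ q ∈ memOf ped liveC (cellOfR n F.L (runProfile F.L R) ped cellP) K τ,
              pshapeTH Prod.fst O C 1 ((F.L : ℝ) ^ d) (R K) (D.C ⟨K, F.m, g₀ K⟩).flow.g 0 (κ K q) q.2) →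
        (∀ K t, |t| ≤ l₀ → K₀ ≤ K →
          ∀ τ ∈ badTerms (memOf ped liveC (cellOfR n F.L (runProfile F.L R) ped cellP)) jhalf T K,
          Fc' K (bstrOf Prod.fst (memOf ped liveC (cellOfR n F.L (runProfile F.L R) ped cellP)) K τ) *
              Rf' K (bstrOf Prod.fst (memOf ped liveC (cellOfR n F.L (runProfile F.L R) ped cellP)) K τ) ≤
            ∏ q ∈ memOf ped liveC (cellOfR n F.L (runProfile F.L R) ped cellP) K τ,
              pshapeTH Prod.fst O C 1 ((F.L : ℝ) ^ d) (R K) (D.C ⟨K, F.m, g₀ K⟩).flow.g 0 (κ' K q) q.2) →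
      -- H3: the remaining `Regeneration` numerator readings, over the classes of the terms (run A, then run B)
        (∀ K t, |t| ≤ l₀ → K₀ ≤ K →
          ∀ c ∈ badClasses Prod.fst (memOf ped liveC (cellOfR n F.L (runProfile F.L R) ped cellP)) jhalf T K,
          ∀ τ ∈ fibre (bstrOf Prod.fst (memOf ped liveC (cellOfR n F.L (runProfile F.L R) ped cellP))) T K c,
            A K t τ ≤ dead K t τ * Fc K c * nup K t) →
        (∀ K t, |t| ≤ l₀ → K₀ ≤ K →
          ∀ c ∈ badClasses Prod.fst (memOf ped liveC (cellOfR n F.L (runProfile F.L R) ped cellP)) jhalf T K,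
          ∀ τ ∈ fibre (bstrOf Prod.fst (memOf ped liveC (cellOfR n F.L (runProfile F.L R) ped cellP))) T K c,
            0 ≤ dead K t τ) →
        (∀ K t, |t| ≤ l₀ → K₀ ≤ K →
          ∀ c ∈ badClasses Prod.fst (memOf ped liveC (cellOfR n F.L (runProfile F.L R) ped cellP)) jhalf T K,
          ∑ τ ∈ fibre (bstrOf Prod.fst (memOf ped liveC (cellOfR n F.L (runProfile F.L R) ped cellP))) T K c,
            dead K t τ ≤ Rf K c) →
        (∀ K t, |t| ≤ l₀ → K₀ ≤ K →
          ∀ c ∈ badClasses Prod.fst (memOf ped liveC (cellOfR n F.L (runProfile F.L R) ped cellP)) jhalf T K,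
            0 ≤ Fc K c) →
        (∀ K t, |t| ≤ l₀ → K₀ ≤ K →
          ∀ c ∈ badClasses Prod.fst (memOf ped liveC (cellOfR n F.L (runProfile F.L R) ped cellP)) jhalf T K,
          ∀ τ ∈ fibre (bstrOf Prod.fst (memOf ped liveC (cellOfR n F.L (runProfile F.L R) ped cellP))) T K c,
            A' K t τ ≤ dead' K t τ * Fc' K c * mup K t) →
        (∀ K t, |t| ≤ l₀ → K₀ ≤ K →
          ∀ c ∈ badClasses Prod.fst (memOf ped liveC (cellOfR n F.L (runProfile F.L R) ped cellP)) jhalf T K,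
          ∀ τ ∈ fibre (bstrOf Prod.fst (memOf ped liveC (cellOfR n F.L (runProfile F.L R) ped cellP))) T K c,
            0 ≤ dead' K t τ) →
        (∀ K t, |t| ≤ l₀ → K₀ ≤ K →
          ∀ c ∈ badClasses Prod.fst (memOf ped liveC (cellOfR n F.L (runProfile F.L R) ped cellP)) jhalf T K,
          ∑ τ ∈ fibre (bstrOf Prod.fst (memOf ped liveC (cellOfR n F.L (runProfile F.L R) ped cellP))) T K c,
            dead' K t τ ≤ Rf' K c) →
        (∀ K t, |t| ≤ l₀ → K₀ ≤ K →
          ∀ c ∈ badClasses Prod.fst (memOf ped liveC (cellOfR n F.L (runProfile F.L R) ped cellP)) jhalf T K,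
            0 ≤ Fc' K c) →
      -- the seam's other inputs: NE7c's shell weight bound, NE7's core budget, four summable rates
        ShellWeightBound l₀ T A A' shA shB Wsh →
        ReindexedBudget l₀ vol T (fun K t τ => A K t τ - shA K t τ) (fun K t τ => A' K t τ - shB K t τ)
          (badOfClass (bstrOf Prod.fst (memOf ped liveC (cellOfR n F.L (runProfile F.L R) ped cellP))) T
            (fun K _ => badClasses Prod.fst (memOf ped liveC (cellOfR n F.L (runProfile F.L R) ped cellP)) jhalf T K))
          Cc Rr CcRec RrRec ν u s₂ q₀ r s →
        Summable r → Summable u → Summable s → Summable s₂ →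
      ∃ K₁ K₂, K₀ ≤ K₁ ∧ HybridNE7 l₀ vol (fun K => T (K₁ + (K₂ + K))) (fun K => A (K₁ + (K₂ + K)))
        (fun K => A' (K₁ + (K₂ + K)))
        (fun K => badOfClass (bstrOf Prod.fst (memOf ped liveC (cellOfR n F.L (runProfile F.L R) ped cellP))) T
          (fun K _ => badClasses Prod.fst (memOf ped liveC (cellOfR n F.L (runProfile F.L R) ped cellP)) jhalf T K)
            (K₁ + (K₂ + K)))
        (fun K => constOf l₀ B Em n₁ c₀ Nup *
          recordsBudget (birthMass C) C.κ₁ ((n : ℝ) ^ d) ((F.L : ℝ) ^ d) (Real.log 2) jhalf (K₁ + (K₂ + K)))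
        (fun K => shA (K₁ + (K₂ + K))) (fun K => shB (K₁ + (K₂ + K))) (fun K => Wsh (K₁ + (K₂ + K)))
        (fun K => (r (K₁ + (K₂ + K)) + u (K₁ + (K₂ + K))) + (s (K₁ + (K₂ + K)) + s₂ (K₁ + (K₂ + K)))) := by
  -- thresholds: the flow side from `BetaPertHyp`, the (B) side from the pin, the infrared clause from `g₁`
  obtain ⟨hβ₁, hβhalf⟩ := beta0_le_of_L_mul_le (F := F) hLβ
  obtain ⟨γ₀, b, β', _hγ₀, hb, _hbβ, hlo, hhi, γf, hγf, hγf₀, hS⟩ :=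
    flowSide_of_betaPertHyp D hβ hβ₀ hβ₁ hLβ (max C.p₀ rr)
  obtain ⟨γB, hγB, em, ep, hcor⟩ := hB.2
  refine ⟨min γf γB, lt_min hγf hγB, fun γ hγ hγle => ?_⟩
  obtain ⟨hSm, hγβ⟩ := hS γ hγ (hγle.trans (min_le_left _ _))
  refine ⟨min 1 (Real.exp (-(irThresholdTLE C F.L rr β₀) / 2)), lt_min one_pos (Real.exp_pos _),
    fun g hg hgle => ⟨max (em g) 0, le_max_right _ _, fun g₀ ht => ?_⟩⟩
  have hir : irThresholdTLE C F.L rr β₀ ≤ Real.log (g ^ 2)⁻¹ :=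
    le_log_inv_sq_of_le_exp hg (hgle.trans (min_le_right _ _))
  intro ι _ α π _ _ l₀ vol K₀ T A A' shA shB dead dead' nup mup Nup Cc Rr CcRec RrRec ν u s₂ q₀ r s Wsh obs B hobs
    hbd hα hα' c₀ n₁ hc₀ hfloor hfloor' hsites hsites' hNup hnup hmup R hR hR1 ped cellP liveC Zd H κ κ' hκ hκ' Fc Rf
    Fc' Rf' hP hP' up dead_nonneg resum F_nonneg up' dead'_nonneg resum' F'_nonneg hSh hTB hr hu hs hs₂
  exact hybridNE7_of_realisedDomainsRun_printed D hD h hμ d n hκ₁ hE₀ hb.le hlo hhi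
    (hγle.trans ((min_le_left _ _).trans hγf₀)) hγβ hSm (le_max_left _ _) (le_max_right _ _) hβhalf ht hir hsign
    hcor (hγle.trans (min_le_right _ _)) hobs hbd hα hα' hc₀ hfloor hfloor' hsites hsites' hNup hnup hmup R hR
    (four_le_L F) hn₁ hR1 ped cellP liveC Zd H hn κ κ' hκ hκ' hP hP' up dead_nonneg resum F_nonneg up' dead'_nonneg
    resum' F'_nonneg hSh hTB hr hu hs hs₂

end Pinned

end

end Summit.QuantumFields.BalabanUV.T4Continuum.HistoryRealiseCellsRunPinned
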